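import Summits.QuantumFields.QCD.Theorems.QuarksAsStableActionStableActionBridgeSliceNilpotent

/-!
# Conjugating the fermionic one-particle transfer matrix by `1 ⊗ γ₄γ₅`
(helper for crux stmt-QuantumFields-9737 `QuarksAsStableAction.StableActionBridge`, line `Sketch` —
stubs `fermionSliceMatrix_conj_gamma05` and `sliceKron_gammaZero_mul_sliceDiracKinetic`)

Smit's one-particle matrix of the fermionic transfer operator of `r = 1` Wilson quarks
(*Introduction to Quantum Fields on a Lattice*, §6.5 (6.91)) is
`M_F = (1 − N)(A⁻¹ ⊗ P⁺ + A ⊗ P⁻)(1 − Nᴴ)` (`fermionSliceMatrix`), with `P± = ½ (1 ± γ₄)`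
(`timeProjPlus`, `timeProjMinus`, `γ₄ := euclideanGamma 0`), the Hermitian kinetic matrix
`D = ½ ∑ⱼ (W_j − W_jᴴ) ⊗ γ₄γ_j` (`sliceDiracKinetic`) and the pair coupling
`N = (1 ⊗ P⁻) D (1 ⊗ P⁺)` (`sliceNilp`).  The transfer form of the Wilson determinant landed by
the lead uses instead `M = (1 + Nᴴ)(A ⊗ P⁺ + A⁻¹ ⊗ P⁻)(1 + N)`.  The two are conjugate under the
unitary spin rotation `V = 1 ⊗ γ₄γ₅`, `V⁻¹ = 1 ⊗ γ₅γ₄`:  `V M_F V⁻¹ = M`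
(`fermionSliceMatrix_conj_gamma05`).

Mechanism (all at the level of the `4 × 4` spin algebra, lifted by the `sliceKron` toolkit of
`SliceNilpotent`): `γ₅² = 1` and `γ₅ γ_μ = −γ_μ γ₅`, hence `γ₄γ₅ P∓ = P± γ₄γ₅` and `γ₄γ₅`
anticommutes with every `γ₄γ_j`; consequently `V` swaps `1 ⊗ P⁺ ↔ 1 ⊗ P⁻`, anticommutes with `D`,
and so `V N = −Nᴴ V`, `V Nᴴ = −N V`, while `V (A⁻¹ ⊗ P⁺ + A ⊗ P⁻) = (A ⊗ P⁺ + A⁻¹ ⊗ P⁻) V`.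
The second stub `sliceKron_gammaZero_mul_sliceDiracKinetic` is the one-line identity
`(1 ⊗ γ₄) D = ½ ∑ⱼ (W_j − W_jᴴ) ⊗ γ_j` (`γ₄² = 1`).  Pure theorem file (no definitions).
-/

noncomputable section

namespace Summit.QuantumFields.QCD.Cruxes.StableActionBridge.Sketch

open scoped ComplexOrder
open MeasureTheory Matrix Literature.MathematicalPhysics.QuantumFieldTheory
  Literature.MathematicalPhysics.QuantumLattice

namespace SliceGammaConjugation

/-! ### The `4 × 4` spin algebra of `γ₅` and `γ₄γ₅` -/

/-- `γ₅² = 1` and `γ₅ γ_μ = -γ_μ γ₅` for every `μ` (chiral basis, `γ₅ = diag(1, 1, -1, -1)`;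
checked on the explicit matrices).  The two conjuncts are the landed
`QuantumLattice.gammaFive_mul_self` / `QuantumLattice.gammaFive_mul_euclideanGamma` of
`QuantumLattice/SpectralLocalizer.lean`; they are re-derived here (four lines) rather than imported
for the reason recorded at `QCDThermalDeterminant.gammaFive_mul_gammaFive`: that module imports
`TopologicalCriticalMass` and with it the barrier file
`Barriers/QuantumFields/WilsonDeterminantSign` (+11 modules), which must stay out of this crux's
import cone. -/
theorem gammaFive_mul_self_and_mul_euclideanGamma :
    gammaFive * gammaFive = 1 ∧
      ∀ μ : Fin 4, gammaFive * euclideanGamma μ = -(euclideanGamma μ * gammaFive) := by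
  -- adapted from `QuantumLattice.gammaFive_mul_self` (SpectralLocalizer.lean)
  rw [gammaFive_eq_diagonal]
  refine ⟨?_, fun μ => ?_⟩
  · rw [diagonal_mul_diagonal, ← diagonal_one]
    congr 1
    funext i
    fin_cases i <;> simp
  · ext α β
    rw [diagonal_mul, Matrix.neg_apply, mul_diagonal]
    fin_cases μ <;> fin_cases α <;> fin_cases β <;>
      simp [euclideanGamma_zero, euclideanGamma_one, euclideanGamma_two, euclideanGamma_three]

/-- `γ₄ γ₅ γ₄ = -γ₅`. -/
theorem gammaZero_mul_gammaFive_mul_gammaZero :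
    euclideanGamma 0 * gammaFive * euclideanGamma 0 = -gammaFive := by
  rw [Matrix.mul_assoc, gammaFive_mul_self_and_mul_euclideanGamma.2, Matrix.mul_neg,
    ← Matrix.mul_assoc, euclideanGamma_mul_self, Matrix.one_mul]

/-- `(γ₄γ₅)(γ₅γ₄) = 1`. -/
theorem gamma05_mul_gamma50 :
    euclideanGamma 0 * gammaFive * (gammaFive * euclideanGamma 0) = 1 := by
  rw [Matrix.mul_assoc, ← Matrix.mul_assoc gammaFive, gammaFive_mul_self_and_mul_euclideanGamma.1,
    Matrix.one_mul, euclideanGamma_mul_self]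

/-- `γ₄γ₅ P⁻ = P⁺ γ₄γ₅`. -/
theorem gamma05_mul_timeProjMinus :
    euclideanGamma 0 * gammaFive * timeProjMinus =
      timeProjPlus * (euclideanGamma 0 * gammaFive) := by
  simp only [timeProjMinus, timeProjPlus, Matrix.mul_smul, Matrix.smul_mul, Matrix.mul_sub,
    Matrix.add_mul, Matrix.mul_one, Matrix.one_mul]
  rw [gammaZero_mul_gammaFive_mul_gammaZero, sub_neg_eq_add, ← Matrix.mul_assoc,
    euclideanGamma_mul_self, Matrix.one_mul]

/-- `γ₄γ₅ P⁺ = P⁻ γ₄γ₅`. -/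
theorem gamma05_mul_timeProjPlus :
    euclideanGamma 0 * gammaFive * timeProjPlus =
      timeProjMinus * (euclideanGamma 0 * gammaFive) := by
  simp only [timeProjMinus, timeProjPlus, Matrix.mul_smul, Matrix.smul_mul, Matrix.mul_add,
    Matrix.sub_mul, Matrix.mul_one, Matrix.one_mul]
  rw [gammaZero_mul_gammaFive_mul_gammaZero, ← sub_eq_add_neg, ← Matrix.mul_assoc,
    euclideanGamma_mul_self, Matrix.one_mul]

/-- `γ₄γ₅` anticommutes with `γ₄γ_k` for every spatial direction `k = j.succ`. -/
theorem gamma05_mul_gamma0k (j : Fin 3) :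
    euclideanGamma 0 * gammaFive * (euclideanGamma 0 * euclideanGamma j.succ) =
      -(euclideanGamma 0 * euclideanGamma j.succ * (euclideanGamma 0 * gammaFive)) := by
  have hk : j.succ ≠ (0 : Fin 4) := Fin.succ_ne_zero j
  calc euclideanGamma 0 * gammaFive * (euclideanGamma 0 * euclideanGamma j.succ)
      = euclideanGamma 0 * gammaFive * euclideanGamma 0 * euclideanGamma j.succ := by
        rw [← Matrix.mul_assoc]
    _ = euclideanGamma j.succ * gammaFive := by
        rw [gammaZero_mul_gammaFive_mul_gammaZero, Matrix.neg_mul,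
          gammaFive_mul_self_and_mul_euclideanGamma.2, neg_neg]
    _ = -(euclideanGamma 0 * euclideanGamma j.succ * (euclideanGamma 0 * gammaFive)) := by
        rw [Matrix.mul_assoc, ← Matrix.mul_assoc (euclideanGamma j.succ) (euclideanGamma 0),
          euclideanGamma_mul_of_ne hk, Matrix.neg_mul, Matrix.mul_neg, neg_neg,
          ← Matrix.mul_assoc, ← Matrix.mul_assoc, euclideanGamma_mul_self, Matrix.one_mul]

/-! ### Lifting to the slice quark modes -/

variable {Nf S : ℕ} [NeZero S]

omit [NeZero S] in
/-- `D` is Hermitian: `(W_j − W_jᴴ)ᴴ = −(W_j − W_jᴴ)` and `(γ₄γ_j)ᴴ = γ_jγ₄ = −γ₄γ_j`. -/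
theorem sliceDiracKinetic_conjTranspose
    (V : GaugeConfig 3 S (Matrix.specialUnitaryGroup (Fin 3) ℂ)) :
    (sliceDiracKinetic (Nf := Nf) V)ᴴ = sliceDiracKinetic V := by
  unfold sliceDiracKinetic
  rw [conjTranspose_smul, conjTranspose_sum, TimeKernelPosDef.star_one_half]
  congr 1
  refine Finset.sum_congr rfl fun j _ => ?_
  have hk : j.succ ≠ (0 : Fin 4) := Fin.succ_ne_zero j
  rw [SliceNilpotent.sliceKron_conjTranspose, conjTranspose_sub, conjTranspose_conjTranspose,
    conjTranspose_mul, (euclideanGamma_isHermitian 0).eq, (euclideanGamma_isHermitian j.succ).eq,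
    euclideanGamma_mul_of_ne hk, SliceNilpotent.sliceKron_neg_right,
    ← SliceNilpotent.sliceKron_neg_left, neg_sub]

/-- `Nᴴ = (1 ⊗ P⁺) D (1 ⊗ P⁻)`. -/
theorem sliceNilp_conjTranspose (V : GaugeConfig 3 S (Matrix.specialUnitaryGroup (Fin 3) ℂ)) :
    (sliceNilp (Nf := Nf) V)ᴴ =
      sliceKron 1 timeProjPlus * sliceDiracKinetic V * sliceKron 1 timeProjMinus := by
  unfold sliceNilp
  rw [conjTranspose_mul, conjTranspose_mul, SliceNilpotent.sliceKron_conjTranspose,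
    SliceNilpotent.sliceKron_conjTranspose, conjTranspose_one,
    TimeKernelPosDef.timeProjPlus_isHermitian.eq, TimeKernelPosDef.timeProjMinus_isHermitian.eq,
    sliceDiracKinetic_conjTranspose, Matrix.mul_assoc]

/-- `(1 ⊗ γ₄γ₅)(1 ⊗ P⁻) = (1 ⊗ P⁺)(1 ⊗ γ₄γ₅)`. -/
theorem gamma05_sliceKron_timeProjMinus :
    sliceKron (Nf := Nf) (S := S) 1 (euclideanGamma 0 * gammaFive) * sliceKron 1 timeProjMinus =
      sliceKron 1 timeProjPlus * sliceKron 1 (euclideanGamma 0 * gammaFive) := by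
  rw [SliceNilpotent.sliceKron_mul, SliceNilpotent.sliceKron_mul, gamma05_mul_timeProjMinus]

/-- `(1 ⊗ γ₄γ₅)(1 ⊗ P⁺) = (1 ⊗ P⁻)(1 ⊗ γ₄γ₅)`. -/
theorem gamma05_sliceKron_timeProjPlus :
    sliceKron (Nf := Nf) (S := S) 1 (euclideanGamma 0 * gammaFive) * sliceKron 1 timeProjPlus =
      sliceKron 1 timeProjMinus * sliceKron 1 (euclideanGamma 0 * gammaFive) := by
  rw [SliceNilpotent.sliceKron_mul, SliceNilpotent.sliceKron_mul, gamma05_mul_timeProjPlus]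

/-- `1 ⊗ γ₄γ₅` anticommutes with `D`. -/
theorem gamma05_mul_sliceDiracKinetic
    (V : GaugeConfig 3 S (Matrix.specialUnitaryGroup (Fin 3) ℂ)) :
    sliceKron (Nf := Nf) (S := S) 1 (euclideanGamma 0 * gammaFive) * sliceDiracKinetic V =
      -(sliceDiracKinetic V * sliceKron 1 (euclideanGamma 0 * gammaFive)) := by
  unfold sliceDiracKinetic
  rw [Matrix.mul_smul, Matrix.smul_mul, Finset.mul_sum, Finset.sum_mul, ← smul_neg,
    ← Finset.sum_neg_distrib]
  congr 1
  refine Finset.sum_congr rfl fun j _ => ?_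
  rw [SliceNilpotent.sliceKron_mul, SliceNilpotent.sliceKron_mul, Matrix.one_mul, Matrix.mul_one,
    gamma05_mul_gamma0k, SliceNilpotent.sliceKron_neg_right]

/-- `(1 ⊗ γ₄γ₅) N = -Nᴴ (1 ⊗ γ₄γ₅)`. -/
theorem gamma05_mul_sliceNilp (V : GaugeConfig 3 S (Matrix.specialUnitaryGroup (Fin 3) ℂ)) :
    sliceKron (Nf := Nf) (S := S) 1 (euclideanGamma 0 * gammaFive) * sliceNilp V =
      -((sliceNilp V)ᴴ * sliceKron 1 (euclideanGamma 0 * gammaFive)) := by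
  rw [sliceNilp_conjTranspose]
  unfold sliceNilp
  rw [← Matrix.mul_assoc, ← Matrix.mul_assoc, gamma05_sliceKron_timeProjMinus,
    Matrix.mul_assoc _ _ (sliceDiracKinetic V), gamma05_mul_sliceDiracKinetic, Matrix.mul_neg,
    Matrix.neg_mul, Matrix.mul_assoc, Matrix.mul_assoc, gamma05_sliceKron_timeProjPlus,
    ← Matrix.mul_assoc, ← Matrix.mul_assoc]

/-- `(1 ⊗ γ₄γ₅) Nᴴ = -N (1 ⊗ γ₄γ₅)`. -/
theorem gamma05_mul_sliceNilp_conjTranspose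
    (V : GaugeConfig 3 S (Matrix.specialUnitaryGroup (Fin 3) ℂ)) :
    sliceKron (Nf := Nf) (S := S) 1 (euclideanGamma 0 * gammaFive) * (sliceNilp V)ᴴ =
      -(sliceNilp V * sliceKron 1 (euclideanGamma 0 * gammaFive)) := by
  rw [sliceNilp_conjTranspose]
  unfold sliceNilp
  rw [← Matrix.mul_assoc, ← Matrix.mul_assoc, gamma05_sliceKron_timeProjPlus,
    Matrix.mul_assoc _ _ (sliceDiracKinetic V), gamma05_mul_sliceDiracKinetic, Matrix.mul_neg,
    Matrix.neg_mul, Matrix.mul_assoc, Matrix.mul_assoc, gamma05_sliceKron_timeProjMinus,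
    ← Matrix.mul_assoc, ← Matrix.mul_assoc]

/-- `(1 ⊗ γ₄γ₅)(A⁻¹ ⊗ P⁺ + A ⊗ P⁻) = (A ⊗ P⁺ + A⁻¹ ⊗ P⁻)(1 ⊗ γ₄γ₅)`. -/
theorem gamma05_mul_timeKernel (A : Matrix (SliceColourVar Nf S) (SliceColourVar Nf S) ℂ) :
    sliceKron 1 (euclideanGamma 0 * gammaFive) *
        (sliceKron A⁻¹ timeProjPlus + sliceKron A timeProjMinus) =
      (sliceKron A timeProjPlus + sliceKron A⁻¹ timeProjMinus) *
        sliceKron 1 (euclideanGamma 0 * gammaFive) := by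
  rw [Matrix.mul_add, Matrix.add_mul, SliceNilpotent.sliceKron_mul, SliceNilpotent.sliceKron_mul,
    SliceNilpotent.sliceKron_mul, SliceNilpotent.sliceKron_mul, Matrix.one_mul, Matrix.one_mul,
    Matrix.mul_one, Matrix.mul_one, gamma05_mul_timeProjPlus, gamma05_mul_timeProjMinus, add_comm]

/-- `(1 ⊗ γ₄γ₅)(1 ⊗ γ₅γ₄) = 1`. -/
theorem gamma05_sliceKron_mul_gamma50_sliceKron :
    sliceKron (Nf := Nf) (S := S) 1 (euclideanGamma 0 * gammaFive) *
        sliceKron 1 (gammaFive * euclideanGamma 0) = 1 := by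
  rw [SliceNilpotent.sliceKron_mul, Matrix.mul_one, gamma05_mul_gamma50,
    SliceNilpotent.sliceKron_one_one]

/-- Conjugating a triple product factor by factor: if `u xᵢ = yᵢ u` (`i = 1, 2, 3`) and `u v = 1`
then `u (x₁ x₂ x₃) v = y₁ y₂ y₃`. -/
theorem conj_mul_mul_eq {R : Type*} [Monoid R] {u v x₁ x₂ x₃ y₁ y₂ y₃ : R}
    (h₁ : u * x₁ = y₁ * u) (h₂ : u * x₂ = y₂ * u) (h₃ : u * x₃ = y₃ * u) (huv : u * v = 1) :
    u * (x₁ * x₂ * x₃) * v = y₁ * y₂ * y₃ := by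
  rw [← mul_assoc u, ← mul_assoc u, h₁, mul_assoc y₁ u, h₂, ← mul_assoc y₁, mul_assoc _ u x₃, h₃,
    ← mul_assoc (y₁ * y₂), mul_assoc _ u v, huv, mul_one]

end SliceGammaConjugation

/-- **Stub `fermionSliceMatrix_conj_gamma05` of line `Sketch`.**  Smit's one-particle fermionic
transfer matrix `M_F = (1 − N)(A⁻¹ ⊗ P⁺ + A ⊗ P⁻)(1 − Nᴴ)` (§6.5 (6.91)) is conjugate, under the
unitary spin rotation `V = 1 ⊗ γ₄γ₅` (`V⁻¹ = 1 ⊗ γ₅γ₄`), to the matrix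
`(1 + Nᴴ)(A ⊗ P⁺ + A⁻¹ ⊗ P⁻)(1 + N)` of the lead's transfer form of the Wilson determinant:
`V M_F V⁻¹ = (1 + Nᴴ)(A ⊗ P⁺ + A⁻¹ ⊗ P⁻)(1 + N)`. -/
theorem fermionSliceMatrix_conj_gamma05 : ∀ (Nf S : ℕ) [NeZero S] (V : GaugeConfig 3 S (Matrix.specialUnitaryGroup (Fin 3) ℂ)) (mq : Fin Nf → ℝ), sliceKron (Nf := Nf) (S := S) 1 (euclideanGamma 0 * gammaFive) * fermionSliceMatrix V mq * sliceKron 1 (gammaFive * euclideanGamma 0) = (1 + (sliceNilp V)ᴴ) * (sliceKron (sliceMassHop V mq) timeProjPlus + sliceKron (sliceMassHop V mq)⁻¹ timeProjMinus) * (1 + sliceNilp V) := by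
  intro Nf S _ V mq
  unfold fermionSliceMatrix
  refine SliceGammaConjugation.conj_mul_mul_eq ?_ (SliceGammaConjugation.gamma05_mul_timeKernel _)
    ?_ SliceGammaConjugation.gamma05_sliceKron_mul_gamma50_sliceKron
  · rw [Matrix.mul_sub, Matrix.mul_one, Matrix.add_mul, Matrix.one_mul,
      SliceGammaConjugation.gamma05_mul_sliceNilp, sub_neg_eq_add]
  · rw [Matrix.mul_sub, Matrix.mul_one, Matrix.add_mul, Matrix.one_mul,
      SliceGammaConjugation.gamma05_mul_sliceNilp_conjTranspose, sub_neg_eq_add]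

/-- **Stub `sliceKron_gammaZero_mul_sliceDiracKinetic` of line `Sketch`.**
`(1 ⊗ γ₄) D = ½ ∑ⱼ (W_j − W_jᴴ) ⊗ γ_j`, since `D = ½ ∑ⱼ (W_j − W_jᴴ) ⊗ γ₄γ_j` and `γ₄² = 1`. -/
theorem sliceKron_gammaZero_mul_sliceDiracKinetic : ∀ (Nf S : ℕ) [NeZero S] (V : GaugeConfig 3 S (Matrix.specialUnitaryGroup (Fin 3) ℂ)), sliceKron (Nf := Nf) (S := S) 1 (euclideanGamma 0) * sliceDiracKinetic (Nf := Nf) V = (1 / 2 : ℂ) • ∑ j : Fin 3, sliceKron (colourHop (Nf := Nf) V j - (colourHop (Nf := Nf) V j)ᴴ) (euclideanGamma j.succ) := by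
  intro Nf S _ V
  unfold sliceDiracKinetic
  rw [Matrix.mul_smul, Finset.mul_sum]
  congr 1
  refine Finset.sum_congr rfl fun j _ => ?_
  rw [SliceNilpotent.sliceKron_mul, Matrix.one_mul, ← Matrix.mul_assoc, euclideanGamma_mul_self,
    Matrix.one_mul]

end Summit.QuantumFields.QCD.Cruxes.StableActionBridge.Sketch

end
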